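import Summits.AtomisticToContinuum.Crystallization.Theorems.ChartedPlanarOrderMesoCut
import Summits.AtomisticToContinuum.Crystallization.Theorems.ChartedPlanarOrderWindowCounting
import Summits.AtomisticToContinuum.Crystallization.Theorems.ChartedPlanarOrderMatchedRootBorel
import Summits.AtomisticToContinuum.Crystallization.Theorems.ChartedPlanarOrderBindingSurface

/-!
# «MesoCut» — the door consumes BULK|door (K3, K4) and the final forms (decomp-a2c lens-3 g21 v2; §§5–7 of the twin 7c1db3b2)

Companion of `Theorems/ChartedPlanarOrderMesoCut.lean` (same namespace; split at landing by hand-1 g8 for the 400-line lint, critic row 389 (2)).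
K3 `sparseMisfit_of_bulkDoor` — K5′ verbatim with `R ≥ R₀`: `BulkDefectGapDoor → BindingSurface → WindowCounting → SparseMisfit ν` (`0 < ν ≤ 1/16`);
K4 `gap_and_pert_1_50_of_bulkDoor` / `gap_and_pert_1_50_of_meso`; §7 `gap_and_pert_1_50_of_bulkDoor_final`, ★★ `gap_and_pert_1_50_of_meso_final :
MuEquilibriumDoor → NearHomBulkGap → MesoHomogenisation → VisibleGap (1/50) ∧ PertRegime (1/50)` with SparseNull (p815496), WindowCounting (p813143),
BindingSurface (p816066) and Floor♭ (p814364) discharged BY NAME.  DEF-FREE; axioms standard.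
-/

noncomputable section

open MeasureTheory Set Metric
open Summit.AtomisticToContinuum.Crystallization.Theorems.ChartedPlanarOrderRigidityDoor
open Summit.AtomisticToContinuum.Crystallization.Theorems.ChartedPlanarOrderDensityDichotomy

namespace Summit.AtomisticToContinuum.Crystallization.Theorems.ChartedPlanarOrderMesoCut

/-! ## 5. The door consumes BULK|door (K5′ with `R ≥ R₀`) -/

set_option maxHeartbeats 800000 in
/-- **K3** `BulkDefectGapDoor → BindingSurface → WindowCounting → SparseMisfit ν` (`0 < ν ≤ 1/16`): lens-2's K5′ `sparseMisfit_of_bulk`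
verbatim, except that the window radius is taken `≥ R₀` and BULK is invoked on the root window of the door configuration only. -/
theorem sparseMisfit_of_bulkDoor {ν : ℝ} (hν : 0 < ν) (hν' : ν ≤ 1 / 16)
    (hBu : BulkDefectGapDoor) (hB : BindingSurface) (hW : WindowCounting) : SparseMisfit ν := by
  intro δ hδ ε hε
  obtain ⟨C₁, hC₁, hB'⟩ := hB δ hδ
  obtain ⟨C₀, hC₀, c₃, hc₃, hW₁⟩ := hW δ hδ 1 one_pos
  set P : ℝ := (2 / δ + 1) ^ 3 with hPdef
  have hP : 0 < P := by positivity
  set u : ℝ := min 1 (ε * c₃ / (2 * P)) with hudef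
  have hu : 0 < u := lt_min one_pos (by positivity)
  have hu1 : u ≤ 1 := min_le_left _ _
  have hu2 : u ≤ ε * c₃ / (2 * P) := min_le_right _ _
  obtain ⟨η, hη, C, hC, r, hr, R₀, hR₀, hBu'⟩ := hBu δ hδ ν hν hν' u hu hu1
  obtain ⟨C₂, hC₂, c₃', hc₃', hW₂⟩ := hW δ hδ r hr
  set A : ℝ := (C₁ + C * C₂) / (η * c₃) with hA
  have hA0 : 0 ≤ A := by positivity
  have hR₀0 : 0 < R₀ := by linarith
  refine ⟨2 * A / ε + R₀, by positivity, ?_⟩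
  intro μ hroot hclean hnash hchart hgsc
  set R : ℝ := 2 * A / ε + R₀ with hRdef
  have hR1 : 1 ≤ R := by
    have : 0 ≤ 2 * A / ε := by positivity
    linarith
  have hRR₀ : R₀ ≤ R := by
    have : 0 ≤ 2 * A / ε := by positivity
    linarith
  have hR0 : 0 < R := by linarith
  have hpack : nK (atomsIn μ 0 R) ≤ P * R ^ 3 := nK_atomsIn_le hδ hroot hR1
  obtain ⟨S, h0S, hsep, hμ⟩ := hroot
  have hatom : ∀ p : E3, μ {p} ≠ 0 ↔ p ∈ S := by
    intro p; rw [hμ]; exact Literature.Probability.Process.count_restrict_singleton_ne_zero_iff S p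
  have hKS : atomsIn μ 0 R ⊆ S := fun p hp => (hatom p).1 hp.1
  have hKfin : (atomsIn μ 0 R).Finite := by
    have hf : (Metric.closedBall (0 : E3) R ∩ S).Finite :=
      Literature.Probability.Process.LocalConfig.finite_inter_of_separated hδ hsep (isCompact_closedBall (0 : E3) R)
    exact hf.subset fun p hp => ⟨Metric.mem_closedBall.2 hp.2, (hatom p).1 hp.1⟩
  have hclean' : IsClean (μS S) := by have h := hclean; rw [hμ] at h; exact h
  have hnash' : IsNash (μS S) := by have h := hnash; rw [hμ] at h; exact h
  have hchart' : IsCharted (μS S) := by have h := hchart; rw [hμ] at h; exact h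
  have hdoor : IsDoorSet δ S := ⟨h0S, hsep, hclean', hnash', hchart'⟩
  -- BULK|door on this window, moved to the `μ`-vocabulary once and for all
  have hbulkμ : u * nK (atomsIn μ 0 R) ≤ nBad ν S (atomsIn μ 0 R) →
      η * nK (atomsIn μ 0 R) ≤ excess S (atomsIn μ 0 R) + C * nBdry r S (atomsIn μ 0 R) := by
    have h := hBu' S hdoor R hRR₀
    have hwin : atomsIn (μS S) 0 R = atomsIn μ 0 R := by
      ext p; simp only [atomsIn, Set.mem_setOf_eq, hμ]
    simpa only [hwin] using h
  -- the μGSC surface bound and the counting bounds, in the chunk vocabulary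
  have hbind : excess S (atomsIn μ 0 R) ≤ C₁ * R ^ 2 := by
    have h := hB' μ ⟨S, h0S, hsep, hμ⟩ hgsc R hR1
    unfold excess
    rw [hμ] at h ⊢
    exact h
  obtain ⟨hbd, -⟩ := hW₂ μ ⟨S, h0S, hsep, hμ⟩ hclean R hR1
  obtain ⟨-, hdens⟩ := hW₁ μ ⟨S, h0S, hsep, hμ⟩ hclean R hR1
  have hbd' : nBdry r S (atomsIn μ 0 R) ≤ C₂ * R ^ 2 := by
    unfold nBdry
    rw [hμ] at hbd ⊢
    exact hbd
  -- each unmatched atom of the window weighs at most 1/(c₃ R³)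
  have hterm : ∀ p ∈ badIn ν μ (atomsIn μ 0 R), (1 : ℝ) / (Set.ncard (atomsIn μ p R) : ℝ) ≤ 1 / (c₃ * R ^ 3) := by
    intro p hp
    have hp' : p ∈ atomsIn μ 0 R := hp.1
    have hd := hdens p hp'.1 hp'.2
    exact one_div_le_one_div_of_le (by positivity) hd
  have hbadfin : (badIn ν μ (atomsIn μ 0 R)).Finite := hKfin.subset (fun p hp => hp.1)
  have hfrac : windowBadFrac ν R μ ≤ (Set.ncard (badIn ν μ (atomsIn μ 0 R)) : ℝ) * (1 / (c₃ * R ^ 3)) := by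
    unfold windowBadFrac
    rw [finsum_mem_eq_finite_toFinset_sum _ hbadfin, Set.ncard_eq_toFinset_card _ hbadfin]
    have hs := Finset.sum_le_card_nsmul hbadfin.toFinset (fun p => (1 : ℝ) / (Set.ncard (atomsIn μ p R) : ℝ)) (1 / (c₃ * R ^ 3))
      (fun p hp => hterm p (hbadfin.mem_toFinset.1 hp))
    simpa [nsmul_eq_mul] using hs
  have hbadμ : (Set.ncard (badIn ν μ (atomsIn μ 0 R)) : ℝ) = nBad ν S (atomsIn μ 0 R) := by
    unfold nBad
    rw [hμ]
  have hR3 : 0 < c₃ * R ^ 3 := by positivity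
  have hc₃0 : c₃ ≠ 0 := hc₃.ne'
  have hη0 : η ≠ 0 := hη.ne'
  have hRne : R ≠ 0 := hR0.ne'
  -- THE DENSITY DICHOTOMY on the window
  have hgoal : nBad ν S (atomsIn μ 0 R) * (1 / (c₃ * R ^ 3)) ≤ ε := by
    rcases lt_or_ge (nBad ν S (atomsIn μ 0 R)) (u * nK (atomsIn μ 0 R)) with hlt | hge
    · -- sparse window: the threshold alone bounds the bad fraction
      have h1 : nBad ν S (atomsIn μ 0 R) ≤ u * (P * R ^ 3) := hlt.le.trans (mul_le_mul_of_nonneg_left hpack hu.le)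
      have h2 : u * (2 * P) ≤ ε * c₃ := (le_div_iff₀ (by positivity)).1 hu2
      calc nBad ν S (atomsIn μ 0 R) * (1 / (c₃ * R ^ 3)) ≤ u * (P * R ^ 3) * (1 / (c₃ * R ^ 3)) :=
            mul_le_mul_of_nonneg_right h1 (by positivity)
        _ = u * P / c₃ := by field_simp
        _ ≤ ε / 2 := by
            rw [div_le_iff₀ hc₃]
            nlinarith [h2]
        _ ≤ ε := by linarith
    · -- dense window: BULK|door bounds the whole window by its surface
      have hbulk : η * nK (atomsIn μ 0 R) ≤ excess S (atomsIn μ 0 R) + C * nBdry r S (atomsIn μ 0 R) := hbulkμ hge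
      have h2 : C * nBdry r S (atomsIn μ 0 R) ≤ C * (C₂ * R ^ 2) := mul_le_mul_of_nonneg_left hbd' hC
      have hnK : nK (atomsIn μ 0 R) ≤ (C₁ + C * C₂) * R ^ 2 / η := by
        rw [le_div_iff₀ hη]
        have : η * nK (atomsIn μ 0 R) ≤ C₁ * R ^ 2 + C * (C₂ * R ^ 2) := by linarith [hbulk, hbind, h2]
        linarith [this]
      have h3 : nBad ν S (atomsIn μ 0 R) ≤ (C₁ + C * C₂) * R ^ 2 / η := (nBad_le_nK ν (S := S) hKfin).trans hnK
      calc nBad ν S (atomsIn μ 0 R) * (1 / (c₃ * R ^ 3)) ≤ (C₁ + C * C₂) * R ^ 2 / η * (1 / (c₃ * R ^ 3)) :=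
            mul_le_mul_of_nonneg_right h3 (by positivity)
        _ = A / R := by
            rw [hA]
            field_simp
        _ ≤ ε / 2 := by
            rw [div_le_iff₀ hR0]
            have hR₀0 : 0 ≤ R₀ := by linarith
            have : 2 * A / ε ≤ R := by linarith
            have h' : 2 * A ≤ R * ε := by rwa [div_le_iff₀ hε] at this
            linarith
        _ ≤ ε := by linarith
  have hfin : (Set.ncard (badIn ν μ (atomsIn μ 0 R)) : ℝ) * (1 / (c₃ * R ^ 3)) ≤ ε := by
    rw [hbadμ]
    exact hgoal
  exact hfrac.trans hfin

/-- **K4** the door corollaries from BULK|door. -/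
theorem visibleGap_of_bulkDoor {ν : ℝ} (hν : 0 < ν) (hν' : ν ≤ 1 / 16)
    (hD : Summit.AtomisticToContinuum.Crystallization.Theses.GrainCoreNetworkSplit.MuEquilibriumDoor)
    (hN : SparseNull ν) (hBu : BulkDefectGapDoor) (hB : BindingSurface) (hW : WindowCounting) : VisibleGap ν :=
  visibleGap_of_door_sparse ν hD hN (sparseMisfit_of_bulkDoor hν hν' hBu hB hW)

/-- **K4** DOOR ∧ SparseNull(≤1/16) ∧ BULK|door ∧ BindingSurface ∧ WindowCounting ⟹ VisibleGap (1/50) ∧ PertRegime (1/50). -/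
theorem gap_and_pert_1_50_of_bulkDoor
    (hD : Summit.AtomisticToContinuum.Crystallization.Theses.GrainCoreNetworkSplit.MuEquilibriumDoor)
    (hN : ∀ η : ℝ, 0 < η → η ≤ 1 / 16 → SparseNull η) (hBu : BulkDefectGapDoor) (hB : BindingSurface) (hW : WindowCounting) :
    VisibleGap (1 / 50) ∧ PertRegime (1 / 50) :=
  ⟨visibleGap_of_bulkDoor (by norm_num) (by norm_num) hD (hN _ (by norm_num) (by norm_num)) hBu hB hW,
    pertRegime_of_door_sparse (1 / 50) hD hN (fun _ hη hη' => sparseMisfit_of_bulkDoor hη hη' hBu hB hW)⟩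

/-- **THE NODE OF RECORD beneath the door after this cut**: DOOR ∧ SparseNull(≤ 1/16) ∧ BindingSurface ∧ WindowCounting ∧ HBG♮ ∧ RED♮
⟹ VisibleGap (1/50) ∧ PertRegime (1/50) (Floor♭ discharged by `chunkFloor_holds`). -/
theorem gap_and_pert_1_50_of_meso
    (hD : Summit.AtomisticToContinuum.Crystallization.Theses.GrainCoreNetworkSplit.MuEquilibriumDoor)
    (hN : ∀ η : ℝ, 0 < η → η ≤ 1 / 16 → SparseNull η) (hB : BindingSurface) (hW : WindowCounting)
    (hG : NearHomBulkGap) (hM : MesoHomogenisation) :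
    VisibleGap (1 / 50) ∧ PertRegime (1 / 50) :=
  gap_and_pert_1_50_of_bulkDoor hD hN (bulkDoor_of_meso chunkFloor_holds hG hM) hB hW

/-! ## 7. Discharging the TRUE pieces that are now tree theorems
`SparseNull ν` for every `ν` (hand-1 p815496 `ChartedPlanarOrderMatchedRootBorel.sparseNull_holds`), `WindowCounting` (p813143
`windowCounting_holds`) and `BindingSurface` (hand-1 p816066 `ChartedPlanarOrderBindingSurface.bindingSurface_holds`): beneath the door only the
route item `MuEquilibriumDoor` and the two pieces HBG♮ ∧ RED♮ remain (`gap_and_pert_1_50_of_meso_final`).  The R⋆ form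
`MuEquilibriumDoor → DiscreteBarlowRigidity → …` is `ChartedPlanarOrderDoorAssembly.gap_and_pert_1_50_of_door_rigidity` (p816108; one source of truth,
critic row 389 (2)) and is not restated here. -/

/-- BULK|door alone: `MuEquilibriumDoor → BulkDefectGapDoor → VisibleGap (1/50) ∧ PertRegime (1/50)` (SparseNull, WindowCounting, BindingSurface
discharged by name). [this work] -/
theorem gap_and_pert_1_50_of_bulkDoor_final
    (hD : Summit.AtomisticToContinuum.Crystallization.Theses.GrainCoreNetworkSplit.MuEquilibriumDoor)
    (hBu : BulkDefectGapDoor) : VisibleGap (1 / 50) ∧ PertRegime (1 / 50) :=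
  gap_and_pert_1_50_of_bulkDoor hD
    (fun η _ _ => Summit.AtomisticToContinuum.Crystallization.Theorems.ChartedPlanarOrderMatchedRootBorel.sparseNull_holds η) hBu
    Summit.AtomisticToContinuum.Crystallization.Theorems.ChartedPlanarOrderBindingSurface.bindingSurface_holds
    Summit.AtomisticToContinuum.Crystallization.Theorems.ChartedPlanarOrderWindowCounting.windowCounting_holds

/-- ★★ FINAL FORM: `MuEquilibriumDoor → HBG♮ → RED♮ → VisibleGap (1/50) ∧ PertRegime (1/50)` — the door's two conclusions from the route item and
the two lens-3 pieces ONLY (Floor♭ by `chunkFloor_holds`). [this work] -/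
theorem gap_and_pert_1_50_of_meso_final
    (hD : Summit.AtomisticToContinuum.Crystallization.Theses.GrainCoreNetworkSplit.MuEquilibriumDoor)
    (hG : NearHomBulkGap) (hM : MesoHomogenisation) :
    VisibleGap (1 / 50) ∧ PertRegime (1 / 50) :=
  gap_and_pert_1_50_of_bulkDoor_final hD (bulkDoor_of_meso chunkFloor_holds hG hM)

end Summit.AtomisticToContinuum.Crystallization.Theorems.ChartedPlanarOrderMesoCut

end
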